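import Literature.AlgebraicGeometry.HodgeTheory.HodgeGenericTypeStabilityOfGenericPoint
import Literature.AlgebraicGeometry.Motives.ComplexPointsManifold
import Literature.AlgebraicGeometry.Motives.MumfordTateInvariantsTensorBasis
import Literature.NumberTheory.Transcendental.AnalytificationSeparatedProofs
import Literature.NumberTheory.Transcendental.AnalytificationSecondCountableProofs
import Mathlib.Topology.Baire.Lemmas
import Mathlib.Topology.Baire.LocallyCompactRegular
import Mathlib.Topology.GDelta.Basic
import Mathlib.Topology.Connected.LocallyPathConnected
import HarnessLib

/-!
# A Hodge-generic point exists when the Hodge loci satisfy the analytic dichotomy (Deligne's Baire argument)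

Family `hodge`, layer `Literature/AlgebraicGeometry/HodgeTheory`; proof file (theorems only, no
definition, no named fact) of the unit `bku_finite_monodromyOrbit_of_isHodgeGenericIn`
(`HodgeGenericQbarDescent.lean`; Baldi–Klingler–Ullmo, Invent. Math. 235 (2024), §3.2).

After `HodgeGenericTypeStabilityOfGenericPoint` the named fact follows from the existence of a
TENSOR-GENERIC point in every such family (`bku_finite_monodromyOrbit_of_isHodgeGenericIn_of_generic`;
Deligne, *La conjecture de Weil pour les surfaces K3* (1972), Prop. 7.5: the Hodge-generic points form
the complement of a meagre set; Klingler, ICM 2022, §2.6). This file PROVES Deligne's argument for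
Prop. 7.5 — Baire's theorem plus analytic continuation of the identity "the flat tensor is of type
`(0,0)`" along paths — on the tree's real carriers (the étalé space `FiberClass f k` of `Rᵏ f_* ℂ` and
its transport `transportFun`, files `DirectImageCovering` / `DirectImageTransport`), leaving as the
ONLY hypothesis its local analytic input, the DICHOTOMY OF HODGE LOCI: inside a small path-connected
open `W` the locus where a flat rational tensor is a Hodge tensor is either all of `W` or nowhere
dense (Cattani–Deligne–Kaplan 1995, §1: "the locus where a flat section remains of type `(p,p)` is a
complex analytic subvariety" — Griffiths' holomorphy of the Hodge bundles — and the identity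
principle on the connected `W`). Results:

* `transportFun_truncate` — transport along the initial segment `γ|[0,u]` is the value at `u` of the
  lift of `γ` (uniqueness of lifts); `transportFun_eq_of_paths_subset`, `transportFun_loop_eq_self`
  — inside a trivialising open transport is path-independent and loops act trivially;
* `full_transfer` — if a property of rational transports holds along all continuations inside a
  chart `W₀` from `(x, Tx)`, and `(x', Tx')` is obtained by continuation inside `W₀`, then on any
  chart `W ∋ x'` whose locus is "all or nowhere dense" it holds along all continuations inside `W`
  (the locus contains the path component of `x'` in `W ∩ W₀`);
* `full_of_generic` — at a point outside the closures of the nowhere-dense loci, a property holding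
  at one admissible state holds along all continuations inside the chart;
* `propagate_of_full` — fullness propagates along every path (clopen argument on `[0, 1]` with the
  lifts of the path, `FiberClass.eventually_eq_fiberRestrict`);
* `exists_generic_of_lociDichotomy` — **the generic point** (abstract form: any cohomologically
  locally trivial `U`, locally path connected, second countable and Baire; countably many
  properties `P i`): Baire's theorem applied to the closures of the nowhere-dense loci based at the
  centres of a countable subcover, over the countably many `(i, T)` (`T` ranges over the countable set
  of isomorphisms of finite-dimensional `ℚ`-spaces);
* `bku_finite_monodromyOrbit_of_isHodgeGenericIn_of_hodgeLociDichotomy` — the named fact from the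
  dichotomy of Hodge loci for smooth projective families over smooth quasi-projective complex bases
  (`S(ℂ)` is a topological manifold: `Motives.ComplexPoints.chartedSpace`, hence locally path
  connected, locally compact and — with Serre's second countability — Baire).

## References

* [Deligne1972WeilK3] P. Deligne, La conjecture de Weil pour les surfaces K3, Invent. Math. 15
  (1972), Prop. 7.5.
* [Klingler2022HodgeICM] B. Klingler, Hodge theory, between algebraicity and transcendence, ICM 2022,
  §2.6.
* [CattaniDeligneKaplan1995JAMS] E. Cattani, P. Deligne, A. Kaplan, On the locus of Hodge classes,
  J. Amer. Math. Soc. 8 (1995), §1.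
* [BaldiKlinglerUllmo2024] G. Baldi, B. Klingler, E. Ullmo, On the distribution of the Hodge locus,
  Invent. Math. 235 (2024), §3.2.
* [VoisinHodgeI2002] C. Voisin, Hodge Theory and Complex Algebraic Geometry I, CUP 2002, §9.2.1.
* [VoisinHodgeII2003] C. Voisin, Hodge Theory and Complex Algebraic Geometry II, CUP 2003, §3.1.2,
  §5.3.1.
* [HatcherAT2002] A. Hatcher, Algebraic Topology, CUP 2002, §1.3 Prop. 1.34.
* [SerreGAGA1956] J.-P. Serre, Géométrie algébrique et géométrie analytique, Ann. Inst. Fourier 6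
  (1956), §2.
* [Liu2002] Q. Liu, Algebraic Geometry and Arithmetic Curves, OUP 2002, Prop. 3.1.23.
-/


noncomputable section

open CategoryTheory AlgebraicGeometry
open _root_.Topology _root_.Filter
open Literature.AlgebraicTopology.SingularHomology
open Literature.AlgebraicGeometry.Motives

namespace Literature.AlgebraicGeometry.HodgeTheory

section HodgeTheory

/-! ### Transport along an initial segment of a path is the lift -/

section Segment

variable {𝒳 S : SchemeOver ℂ} (f : 𝒳 ⟶ S) (k : ℕ) {U : Set (ComplexPoints S)}
  (hU : IsCohomologicallyLocallyTrivialOn f U)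

/-- The extension to `ℝ` of a lift lies over the extension of the base path. [folklore] -/
theorem FiberClass.pt_extend_of_lift {x y : U} (γ : Path x y) {a b : FiberClass f k} (Λ : Path a b)
    (hΛ : ∀ r, (Λ r).pt = (γ r).1) (w : ℝ) : (Λ.extend w).pt = (γ.extend w).1 :=
  hΛ (Set.projIcc 0 1 zero_le_one w)

/-- **Transport along the initial segment `γ|[0,u]` of a path is the value at `u` of the lift of
`γ`** (uniqueness of lifts in the covering space `FiberClass f k|_U → U`; Voisin I §9.2.1,
Hatcher Prop. 1.34). The segment is `Path.truncateOfLE`, cast to a path from `x` to `γ u`.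
[cite: VoisinHodgeI2002, §9.2.1] [cite: HatcherAT2002, §1.3 Prop. 1.34] -/
theorem transportFun_truncate {x y : U} (γ : Path x y) (α : complexBetti (fiberOver f x.1) k)
    {β : complexBetti (fiberOver f y.1) k}
    (Λ : Path (⟨x.1, α⟩ : FiberClass f k) ⟨y.1, β⟩) (hΛ : ∀ r, (Λ r).pt = (γ r).1)
    (u : unitInterval) :
    transportFun f k hU
        ⟦(γ.truncateOfLE u.2.1).cast γ.extend_zero.symm (γ.extend_extends' u).symm⟧ α =
      (Λ u).clsAt (hΛ u) := by
  refine transportFun_eq_of_path f k hU _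
    ((Λ.truncateOfLE u.2.1).cast Λ.extend_zero.symm ?_) (fun r ↦ ?_)
  · rw [Path.extend_extends', FiberClass.mk_clsAt]
  · exact FiberClass.pt_extend_of_lift f k γ Λ hΛ _

end Segment

/-! ### Two additive `ℚ`-homogeneous maps agreeing on a basis agree -/

section Basis

/-- Two additive, `ℚ`-homogeneous maps from a `ℚ`-vector space to a `ℂ`-vector space which agree
on a (finite) basis agree everywhere. [folklore] -/
theorem forall_eq_of_eqOn_basis {W M : Type*} [AddCommGroup W] [Module ℚ W] [AddCommGroup M]
    [Module ℂ M] {J : Type*} [Fintype J] (b : Module.Basis J ℚ W) (g g' : W → M)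
    (hg : ∀ v w, g (v + w) = g v + g w) (hgs : ∀ (q : ℚ) v, g (q • v) = (q : ℂ) • g v)
    (hg' : ∀ v w, g' (v + w) = g' v + g' w) (hgs' : ∀ (q : ℚ) v, g' (q • v) = (q : ℂ) • g' v)
    (h : ∀ j, g (b j) = g' (b j)) (v : W) : g v = g' v := by
  have hg0 : g 0 = 0 := by simpa using hgs 0 0
  have hg0' : g' 0 = 0 := by simpa using hgs' 0 0
  let G : W →+ M := { toFun := g, map_zero' := hg0, map_add' := hg }
  let G' : W →+ M := { toFun := g', map_zero' := hg0', map_add' := hg' }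
  rw [← b.sum_repr v]
  change G (∑ j, b.repr v j • b j) = G' (∑ j, b.repr v j • b j)
  rw [map_sum, map_sum]
  refine Finset.sum_congr rfl fun j _ ↦ ?_
  change g _ = g' _
  rw [hgs, hgs', h]

end Basis

/-! ### Countability of the rational data -/

section Countable

/-- A finite-dimensional `ℚ`-vector space is countable. [folklore] -/
theorem countable_of_module_finite_rat (W : Type*) [AddCommGroup W] [Module ℚ W]
    [Module.Finite ℚ W] : Countable W :=
  (Module.finBasis ℚ W).equivFun.toEquiv.countable_iff.2 inferInstance

/-- The `ℚ`-linear isomorphisms between two finite-dimensional `ℚ`-vector spaces form a countable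
set (an isomorphism is determined by the images of a finite basis). [folklore] -/
theorem countable_linearEquiv_rat (W W' : Type*) [AddCommGroup W] [Module ℚ W] [Module.Finite ℚ W]
    [AddCommGroup W'] [Module ℚ W'] [Module.Finite ℚ W'] : Countable (W ≃ₗ[ℚ] W') := by
  haveI := countable_of_module_finite_rat W'
  let b := Module.finBasis ℚ W
  have hinj : Function.Injective fun T : W ≃ₗ[ℚ] W' ↦ fun j ↦ T (b j) :=
    fun T T' h ↦ b.ext' fun j ↦ congr_fun h j
  exact hinj.countable

end Countable

/-! ### Paths inside a subset -/

section PathMem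

variable {X : Type*} [TopologicalSpace X] {W : Set X}

/-- A concatenation of two paths inside `W` stays inside `W`: duplicate of
`Literature.AlgebraicTopology.FundamentalGroup.VanKampen.trans_mem` (`VanKampenKernel.lean`,
implicit-path form), kept as a deprecated alias (dedup-02469). [folklore] -/
@[deprecated Literature.AlgebraicTopology.FundamentalGroup.VanKampen.trans_mem (since := "2026-08-16")]
theorem forall_mem_path_trans {x y z : X} (p : Path x y) (q : Path y z) (hp : ∀ r, p r ∈ W)
    (hq : ∀ r, q r ∈ W) (r : unitInterval) : p.trans q r ∈ W :=
  AlgebraicTopology.FundamentalGroup.VanKampen.trans_mem hp hq r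

/-- The reverse of a path inside `W` stays inside `W`: duplicate of
`Literature.AlgebraicTopology.FundamentalGroup.VanKampen.symm_mem` (`VanKampenKernel.lean`), kept as
a deprecated alias (dedup-02469). [folklore] -/
@[deprecated Literature.AlgebraicTopology.FundamentalGroup.VanKampen.symm_mem (since := "2026-08-16")]
theorem forall_mem_path_symm {x y : X} (p : Path x y) (hp : ∀ r, p r ∈ W) (r : unitInterval) :
    p.symm r ∈ W :=
  AlgebraicTopology.FundamentalGroup.VanKampen.symm_mem hp r

end PathMem

/-! ### Transport inside a trivialising open: path independence, loops act trivially -/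

section Trivialising

variable {𝒳 S : SchemeOver ℂ} (f : 𝒳 ⟶ S) (k : ℕ) {U : Set (ComplexPoints S)}
  (hU : IsCohomologicallyLocallyTrivialOn f U)

/-- Transport along a concatenation of paths (the functoriality `transportFun_trans`, restated
for classes `⟦p.trans q⟧` of concatenated paths). [cite: VoisinHodgeI2002, §9.2.1] -/
theorem transportFun_mk_trans {x y z : U} (p : Path x y) (q : Path y z)
    (α : complexBetti (fiberOver f x.1) k) :
    transportFun f k hU ⟦p.trans q⟧ α = transportFun f k hU ⟦q⟧ (transportFun f k hU ⟦p⟧ α) :=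
  transportFun_trans f k hU ⟦p⟧ ⟦q⟧ α

/-- Transport along `p` and back along `p.symm` is the identity (restated for classes of paths).
[cite: VoisinHodgeI2002, §9.2.1] -/
theorem transportFun_mk_symm_mk {x y : U} (p : Path x y) (α : complexBetti (fiberOver f x.1) k) :
    transportFun f k hU ⟦p.symm⟧ (transportFun f k hU ⟦p⟧ α) = α :=
  transportFun_symm_transportFun f k hU ⟦p⟧ α

/-- **Inside a trivialising open `B` transport does not depend on the path**: two paths in `B` with
the same endpoints transport every class identically (both transports are restriction of the tube
class; Voisin I §9.2.1 "the stalk … is canonically isomorphic to `Hᵏ(X_t, A)` by restriction").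
[cite: VoisinHodgeI2002, §9.2.1] -/
theorem transportFun_eq_of_paths_subset {B : Set (ComplexPoints S)} (hBo : IsOpen B)
    (hbij : ∀ ⦃z⦄ (hz : z ∈ B), Function.Bijective (fiberRestrict f hz k))
    {x t : U} (hx : x.1 ∈ B) (ht : t.1 ∈ B) (ε ε' : Path x t) (hε : ∀ r, (ε r).1 ∈ B)
    (hε' : ∀ r, (ε' r).1 ∈ B) (α : complexBetti (fiberOver f x.1) k) :
    transportFun f k hU ⟦ε⟧ α = transportFun f k hU ⟦ε'⟧ α := by
  obtain ⟨ξ, rfl⟩ := (hbij hx).2 α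
  rw [transportFun_fiberRestrict f k hU hBo ε hε hx ht,
    transportFun_fiberRestrict f k hU hBo ε' hε' hx ht]

/-- **Loops inside a trivialising open act trivially.** [cite: VoisinHodgeI2002, §9.2.1] -/
theorem transportFun_loop_eq_self {B : Set (ComplexPoints S)} (hBo : IsOpen B)
    (hbij : ∀ ⦃z⦄ (hz : z ∈ B), Function.Bijective (fiberRestrict f hz k))
    {x : U} (hx : x.1 ∈ B) (ε : Path x x) (hε : ∀ r, (ε r).1 ∈ B)
    (α : complexBetti (fiberOver f x.1) k) : transportFun f k hU ⟦ε⟧ α = α := by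
  rw [transportFun_eq_of_paths_subset f k hU hBo hbij hx hx ε (Path.refl x) hε (fun _ ↦ hx) α]
  exact transportFun_refl f k hU x α

/-- Equal base points give equal fibre classes of restrictions of one tube class. [folklore] -/
theorem FiberClass.mk_fiberRestrict_congr {B : Set (ComplexPoints S)} {x y : U} (h : x = y)
    (hx : x.1 ∈ B) (hy : y.1 ∈ B) (ξ : singularCohomology ℂ ℂ (tubeOver f B) k) :
    (⟨x.1, fiberRestrict f hx k ξ⟩ : FiberClass f k) = ⟨y.1, fiberRestrict f hy k ξ⟩ := by
  subst h
  rfl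

end Trivialising

/-! ### Fullness of the locus: the transfer lemma and the generic base point -/

section Transfer

variable {𝒳 S : SchemeOver ℂ} (f : 𝒳 ⟶ S) (k : ℕ) {U : Set (ComplexPoints S)}
  (hU : IsCohomologicallyLocallyTrivialOn f U)

/-- **Transfer of fullness.** Let `W₀ ⊆ B₀` and `W ⊆ B` be path-connected opens inside
trivialising opens, `x, x' ∈ W₀`, `x' ∈ W`, with rational states `Tx`, `Tx'` (isomorphisms from the
fibre at the base point `s`) which are `B₀`-related on a basis (the classes `Tx bⱼ ⊗ 1`,
`Tx' bⱼ ⊗ 1` are restrictions of one tube class over `B₀`). If the property `P` holds along every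
continuation inside `W₀` from `(x, Tx)`, and the locus of `P` along continuations inside `W` from
`(x', Tx')` is either all of `W` or nowhere dense, then it is all of `W`: it contains the path
component of `x'` in `W ∩ W₀`, an open set (Deligne 1972, proof of Prop. 7.5: analytic continuation of
the identity "the flat tensor is of type `(0,0)`"). [cite: Deligne1972WeilK3, Prop. 7.5]
[cite: VoisinHodgeII2003, §5.3.1] -/
theorem full_transfer [LocallyPathConnectedSpace U] (s : U)
    (P : ∀ t : U, (singularCohomology ℚ ℚ (ComplexPoints (fiberOver f (Subtype.val s))) k ≃ₗ[ℚ]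
      singularCohomology ℚ ℚ (ComplexPoints (fiberOver f (Subtype.val t))) k) → Prop)
    {J : Type*} [Fintype J] (b : Module.Basis J ℚ (singularCohomology ℚ ℚ (ComplexPoints (fiberOver f
      (Subtype.val s))) k))
    {W₀ : Set U} {B₀ : Set (ComplexPoints S)} (hW₀o : IsOpen W₀) (hW₀pc : IsPathConnected W₀)
    (hB₀o : IsOpen B₀) (hWB₀ : ∀ t ∈ W₀, (t : ComplexPoints S) ∈ B₀)
    {W : Set U} {B : Set (ComplexPoints S)} (hWo : IsOpen W) (hBo : IsOpen B)
    (hbij : ∀ ⦃z⦄ (hz : z ∈ B), Function.Bijective (fiberRestrict f hz k))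
    (hWB : ∀ t ∈ W, (t : ComplexPoints S) ∈ B)
    {x x' : U} (hx : x ∈ W₀) (hx' : x' ∈ W₀) (hx'W : x' ∈ W)
    {Tx : singularCohomology ℚ ℚ (ComplexPoints (fiberOver f (Subtype.val s))) k ≃ₗ[ℚ]
      singularCohomology ℚ ℚ (ComplexPoints (fiberOver f (Subtype.val x))) k} {Tx' : singularCohomology ℚ ℚ
        (ComplexPoints (fiberOver f (Subtype.val s))) k ≃ₗ[ℚ] singularCohomology ℚ ℚ (ComplexPoints
          (fiberOver f (Subtype.val x'))) k}
    (hrel : ∀ j, ∃ ξ : singularCohomology ℂ ℂ (tubeOver f B₀) k,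
      fiberRestrict f (hWB₀ x hx) k ξ = ofRatClass _ k (Tx (b j)) ∧
      fiberRestrict f (hWB₀ x' hx') k ξ = ofRatClass _ k (Tx' (b j)))
    (hfull₀ : ∀ t ∈ W₀, ∀ (ε : Path x t), (∀ r, ε r ∈ W₀) → ∀ (T : singularCohomology ℚ ℚ (ComplexPoints
      (fiberOver f (Subtype.val s))) k ≃ₗ[ℚ]
      singularCohomology ℚ ℚ (ComplexPoints (fiberOver f (Subtype.val t))) k),
      (∀ v, ofRatClass _ k (T v) = transportFun f k hU ⟦ε⟧ (ofRatClass _ k (Tx v))) → P t T)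
    (hdich : (∀ t ∈ W, ∀ (ε : Path x' t), (∀ r, ε r ∈ W) → ∀ (T : singularCohomology ℚ ℚ (ComplexPoints
      (fiberOver f (Subtype.val s))) k ≃ₗ[ℚ]
      singularCohomology ℚ ℚ (ComplexPoints (fiberOver f (Subtype.val t))) k),
        (∀ v, ofRatClass _ k (T v) = transportFun f k hU ⟦ε⟧ (ofRatClass _ k (Tx' v))) → P t T) ∨
      IsNowhereDense {t : U | t ∈ W ∧ ∀ (ε : Path x' t), (∀ r, ε r ∈ W) →
        ∀ (T : singularCohomology ℚ ℚ (ComplexPoints (fiberOver f (Subtype.val s))) k ≃ₗ[ℚ]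
          singularCohomology ℚ ℚ (ComplexPoints (fiberOver f (Subtype.val t))) k),
        (∀ v, ofRatClass _ k (T v) = transportFun f k hU ⟦ε⟧ (ofRatClass _ k (Tx' v))) → P t T}) :
    ∀ t ∈ W, ∀ (ε : Path x' t), (∀ r, ε r ∈ W) → ∀ (T : singularCohomology ℚ ℚ (ComplexPoints (fiberOver f
      (Subtype.val s))) k ≃ₗ[ℚ]
      singularCohomology ℚ ℚ (ComplexPoints (fiberOver f (Subtype.val t))) k),
      (∀ v, ofRatClass _ k (T v) = transportFun f k hU ⟦ε⟧ (ofRatClass _ k (Tx' v))) → P t T := by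
  choose ξ hξx hξx' using hrel
  -- the locus contains the path component `O` of `x'` in `W ∩ W₀`
  have hO : ∀ t ∈ pathComponentIn (W ∩ W₀) x', t ∈ W ∧ ∀ (ε : Path x' t), (∀ r, ε r ∈ W) →
      ∀ (T : singularCohomology ℚ ℚ (ComplexPoints (fiberOver f (Subtype.val s))) k ≃ₗ[ℚ]
        singularCohomology ℚ ℚ (ComplexPoints (fiberOver f (Subtype.val t))) k),
      (∀ v, ofRatClass _ k (T v) = transportFun f k hU ⟦ε⟧ (ofRatClass _ k (Tx' v))) → P t T := by
    intro t ht
    have htWW₀ : t ∈ W ∩ W₀ := pathComponentIn_subset ht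
    refine ⟨htWW₀.1, fun ε hε T hT ↦ ?_⟩
    have hO' : JoinedIn (W ∩ W₀) x' t := ht
    have h₁ : JoinedIn W₀ x t := hW₀pc.joinedIn x hx t htWW₀.2
    -- on the basis, `T bⱼ ⊗ 1 = ξⱼ|_{X_t}`
    have hTb : ∀ j, ofRatClass _ k (T (b j)) = fiberRestrict f (hWB₀ t htWW₀.2) k (ξ j) := by
      intro j
      rw [hT, transportFun_eq_of_paths_subset f k hU hBo hbij (hWB x' hx'W) (hWB t htWW₀.1) ε
        hO'.somePath (fun r ↦ hWB _ (hε r)) (fun r ↦ hWB _ (hO'.somePath_mem r).1), ← hξx' j,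
        transportFun_fiberRestrict f k hU hB₀o hO'.somePath (fun r ↦ hWB₀ _ (hO'.somePath_mem r).2)
          (hWB₀ x' hx') (hWB₀ t htWW₀.2)]
    refine hfull₀ t htWW₀.2 h₁.somePath h₁.somePath_mem T ?_
    refine forall_eq_of_eqOn_basis b (fun v ↦ ofRatClass _ k (T v))
      (fun v ↦ transportFun f k hU ⟦h₁.somePath⟧ (ofRatClass _ k (Tx v))) ?_ ?_ ?_ ?_ (fun j ↦ ?_)
    · intro v w; simp only [map_add]
    · intro q v; rw [LinearEquiv.map_smul, ofRatClass_smul]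
    · intro v w; simp only [map_add, transportFun_add]
    · intro q v; rw [LinearEquiv.map_smul, ofRatClass_smul, transportFun_smul]
    · change ofRatClass _ k (T (b j)) = transportFun f k hU ⟦h₁.somePath⟧ (ofRatClass _ k (Tx (b j)))
      rw [hTb j, ← hξx j, transportFun_fiberRestrict f k hU hB₀o h₁.somePath
        (fun r ↦ hWB₀ _ (h₁.somePath_mem r)) (hWB₀ x hx) (hWB₀ t htWW₀.2)]
  -- conclude by the dichotomy
  rcases hdich with hfull | hnd
  · exact hfull
  · exfalso
    have hOo : IsOpen (pathComponentIn (W ∩ W₀) x') := (hWo.inter hW₀o).pathComponentIn x'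
    have hx'O : x' ∈ pathComponentIn (W ∩ W₀) x' := mem_pathComponentIn_self ⟨hx'W, hx'⟩
    have hsub : pathComponentIn (W ∩ W₀) x' ⊆ interior (closure {t : U | t ∈ W ∧
        ∀ (ε : Path x' t), (∀ r, ε r ∈ W) → ∀ (T : singularCohomology ℚ ℚ (ComplexPoints (fiberOver f
          (Subtype.val s))) k ≃ₗ[ℚ]
          singularCohomology ℚ ℚ (ComplexPoints (fiberOver f (Subtype.val t))) k),
        (∀ v, ofRatClass _ k (T v) = transportFun f k hU ⟦ε⟧ (ofRatClass _ k (Tx' v))) → P t T}) :=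
      interior_maximal (fun t ht ↦ subset_closure (hO t ht)) hOo
    rw [IsNowhereDense] at hnd
    rw [hnd] at hsub
    exact hsub hx'O

/-- **Fullness at a generic base point.** Let `W ⊆ B` be a path-connected open inside a
trivialising open with reference point `c ∈ W`, and let `t₀ ∈ W` be GENERIC for the loci based at
`c`: `t₀` lies in the closure of no nowhere-dense locus `{t ∈ W | P along continuations in W from
(c, T')}`. If `P t₀ T₀` holds for an admissible state `T₀` (a rational transport along some path from
`s`), then `P` holds along every continuation inside `W` from `(t₀, T₀)` (Deligne 1972, proof of
Prop. 7.5: at a point outside the meagre set, a Hodge tensor stays Hodge nearby).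
[cite: Deligne1972WeilK3, Prop. 7.5] -/
theorem full_of_generic (s : U)
    (hrat : ∀ (x y : U) (γ : Path.Homotopic.Quotient x y) (α : complexBetti (fiberOver f x.1) k),
      IsRationalClass α → IsRationalClass (transportFun f k hU γ α))
    (P : ∀ t : U, (singularCohomology ℚ ℚ (ComplexPoints (fiberOver f (Subtype.val s))) k ≃ₗ[ℚ]
      singularCohomology ℚ ℚ (ComplexPoints (fiberOver f (Subtype.val t))) k) → Prop)
    {W : Set U} {B : Set (ComplexPoints S)} (hWpc : IsPathConnected W) (hBo : IsOpen B)
    (hbij : ∀ ⦃z⦄ (hz : z ∈ B), Function.Bijective (fiberRestrict f hz k))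
    (hWB : ∀ t ∈ W, (t : ComplexPoints S) ∈ B)
    {c t₀ : U} (hc : c ∈ W) (ht₀ : t₀ ∈ W) {δ₀ : Path.Homotopic.Quotient s t₀}
    {T₀ : singularCohomology ℚ ℚ (ComplexPoints (fiberOver f (Subtype.val s))) k ≃ₗ[ℚ]
      singularCohomology ℚ ℚ (ComplexPoints (fiberOver f (Subtype.val t₀))) k}
    (hT₀ : ∀ v, ofRatClass _ k (T₀ v) = transportFun f k hU δ₀ (ofRatClass _ k v))
    (hP : P t₀ T₀)
    (hgen : ∀ T' : singularCohomology ℚ ℚ (ComplexPoints (fiberOver f (Subtype.val s))) k ≃ₗ[ℚ]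
      singularCohomology ℚ ℚ (ComplexPoints (fiberOver f (Subtype.val c))) k,
      IsNowhereDense {t : U | t ∈ W ∧ ∀ (ε : Path c t), (∀ r, ε r ∈ W) →
        ∀ (T : singularCohomology ℚ ℚ (ComplexPoints (fiberOver f (Subtype.val s))) k ≃ₗ[ℚ]
          singularCohomology ℚ ℚ (ComplexPoints (fiberOver f (Subtype.val t))) k),
        (∀ v, ofRatClass _ k (T v) = transportFun f k hU ⟦ε⟧ (ofRatClass _ k (T' v))) → P t T} →
      t₀ ∉ closure {t : U | t ∈ W ∧ ∀ (ε : Path c t), (∀ r, ε r ∈ W) →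
        ∀ (T : singularCohomology ℚ ℚ (ComplexPoints (fiberOver f (Subtype.val s))) k ≃ₗ[ℚ]
          singularCohomology ℚ ℚ (ComplexPoints (fiberOver f (Subtype.val t))) k),
        (∀ v, ofRatClass _ k (T v) = transportFun f k hU ⟦ε⟧ (ofRatClass _ k (T' v))) → P t T})
    (hdich : ∀ T' : singularCohomology ℚ ℚ (ComplexPoints (fiberOver f (Subtype.val s))) k ≃ₗ[ℚ]
      singularCohomology ℚ ℚ (ComplexPoints (fiberOver f (Subtype.val c))) k,
      (∃ δ : Path.Homotopic.Quotient s c,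
        ∀ v, ofRatClass _ k (T' v) = transportFun f k hU δ (ofRatClass _ k v)) →
      (∀ t ∈ W, ∀ (ε : Path c t), (∀ r, ε r ∈ W) → ∀ (T : singularCohomology ℚ ℚ (ComplexPoints (fiberOver f
        (Subtype.val s))) k ≃ₗ[ℚ]
        singularCohomology ℚ ℚ (ComplexPoints (fiberOver f (Subtype.val t))) k),
        (∀ v, ofRatClass _ k (T v) = transportFun f k hU ⟦ε⟧ (ofRatClass _ k (T' v))) → P t T) ∨
      IsNowhereDense {t : U | t ∈ W ∧ ∀ (ε : Path c t), (∀ r, ε r ∈ W) →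
        ∀ (T : singularCohomology ℚ ℚ (ComplexPoints (fiberOver f (Subtype.val s))) k ≃ₗ[ℚ]
          singularCohomology ℚ ℚ (ComplexPoints (fiberOver f (Subtype.val t))) k),
        (∀ v, ofRatClass _ k (T v) = transportFun f k hU ⟦ε⟧ (ofRatClass _ k (T' v))) → P t T}) :
    ∀ t ∈ W, ∀ (ε : Path t₀ t), (∀ r, ε r ∈ W) → ∀ (T : singularCohomology ℚ ℚ (ComplexPoints (fiberOver f
      (Subtype.val s))) k ≃ₗ[ℚ]
      singularCohomology ℚ ℚ (ComplexPoints (fiberOver f (Subtype.val t))) k),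
      (∀ v, ofRatClass _ k (T v) = transportFun f k hU ⟦ε⟧ (ofRatClass _ k (T₀ v))) → P t T := by
  -- a `W`-path from `t₀` to the reference point, and the continued state `T'` at `c`
  have h₀ : JoinedIn W t₀ c := hWpc.joinedIn t₀ ht₀ c hc
  set ε₀ := h₀.somePath with hε₀
  obtain ⟨T', hT'⟩ := exists_ratTransport f k hU hrat (δ₀.trans ⟦ε₀⟧)
  have hT'₀ : ∀ v, ofRatClass _ k (T' v) = transportFun f k hU ⟦ε₀⟧ (ofRatClass _ k (T₀ v)) := by
    intro v
    rw [hT', transportFun_trans, hT₀]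
  rcases hdich T' ⟨_, hT'⟩ with hfull | hnd
  · -- fullness at `c` gives fullness at `t₀`: re-route through `c`
    intro t ht ε hε T hT
    refine hfull t ht (ε₀.symm.trans ε)
      (AlgebraicTopology.FundamentalGroup.VanKampen.trans_mem
        (AlgebraicTopology.FundamentalGroup.VanKampen.symm_mem h₀.somePath_mem) hε) T fun v ↦ ?_
    rw [hT v, hT'₀ v, transportFun_mk_trans, transportFun_mk_symm_mk]
  · -- the nowhere-dense case contradicts genericity: `t₀` lies on the locus based at `c`
    exfalso
    refine hgen T' hnd (subset_closure ⟨ht₀, fun ε hε T hT ↦ ?_⟩)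
    have hTT₀ : T = T₀ := by
      refine LinearEquiv.ext fun v ↦ ofRatClass_injective k ?_
      rw [hT v, hT'₀ v, ← transportFun_mk_trans]
      exact transportFun_loop_eq_self f k hU hBo hbij (hWB t₀ ht₀) (ε₀.trans ε)
        (fun r ↦ hWB _
          (AlgebraicTopology.FundamentalGroup.VanKampen.trans_mem h₀.somePath_mem hε r)) _
    rw [hTT₀]
    exact hP

end Transfer

/-! ### Propagation along a path: the clopen argument on `[0, 1]` -/

section Propagate

variable {𝒳 S : SchemeOver ℂ} (f : 𝒳 ⟶ S) (k : ℕ) {U : Set (ComplexPoints S)}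
  (hU : IsCohomologicallyLocallyTrivialOn f U)

/-- **Propagation of fullness along paths** (Deligne 1972, proof of Prop. 7.5; the monodromy /
analytic-continuation step). Given a family of charts `W_c ⊆ B_c` (path-connected opens inside
trivialising opens) covering `U`, on each of which every locus of `P` based at an admissible state
is all of the chart or nowhere dense, suppose `P` holds along every continuation inside every chart
through `t₀` from an admissible state `(t₀, T₀)`. Then `P t T` for EVERY point `t`, path class `δ`
from `s` and rational transport `T` along `δ`: follow a path `γ` from `t₀` to `t` in the class
`δ₀⁻¹ δ`; the set of parameters `u ∈ [0, 1]` at which fullness holds at `(γ u, T_u)` (`T_u` the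
rational transport along `δ₀ · γ|[0,u]`, read off from the lifts of `γ` to the espace étalé by
`transportFun_truncate`) is open and closed (`full_transfer` in both directions, the lifts being
locally restrictions of tube classes, `FiberClass.eventually_eq_fiberRestrict`) and contains `0`.
[cite: Deligne1972WeilK3, Prop. 7.5] [cite: VoisinHodgeI2002, §9.2.1] -/
theorem propagate_of_full [LocallyPathConnectedSpace U] (s : U)
    (hrat : ∀ (x y : U) (γ : Path.Homotopic.Quotient x y) (α : complexBetti (fiberOver f x.1) k),
      IsRationalClass α → IsRationalClass (transportFun f k hU γ α))
    (P : ∀ t : U, (singularCohomology ℚ ℚ (ComplexPoints (fiberOver f (Subtype.val s))) k ≃ₗ[ℚ]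
      singularCohomology ℚ ℚ (ComplexPoints (fiberOver f (Subtype.val t))) k) → Prop)
    {J : Type*} [Fintype J] (b : Module.Basis J ℚ (singularCohomology ℚ ℚ (ComplexPoints (fiberOver f
      (Subtype.val s))) k))
    {C : Type*} (Wc : C → Set U) (Bc : C → Set (ComplexPoints S))
    (hWo : ∀ c, IsOpen (Wc c)) (hWpc : ∀ c, IsPathConnected (Wc c)) (hBo : ∀ c, IsOpen (Bc c))
    (hBU : ∀ c, Bc c ⊆ U)
    (hbij : ∀ c ⦃z⦄ (hz : z ∈ Bc c), Function.Bijective (fiberRestrict f hz k))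
    (hWB : ∀ c, ∀ t ∈ Wc c, (t : ComplexPoints S) ∈ Bc c)
    (hcov : ∀ t : U, ∃ c, t ∈ Wc c)
    (hdich : ∀ (c : C) (x : U), x ∈ Wc c → ∀ (Tx : singularCohomology ℚ ℚ (ComplexPoints (fiberOver f
      (Subtype.val s))) k ≃ₗ[ℚ]
      singularCohomology ℚ ℚ (ComplexPoints (fiberOver f (Subtype.val x))) k),
      (∃ δ : Path.Homotopic.Quotient s x,
        ∀ v, ofRatClass _ k (Tx v) = transportFun f k hU δ (ofRatClass _ k v)) →
      (∀ t ∈ Wc c, ∀ (ε : Path x t), (∀ r, ε r ∈ Wc c) → ∀ (T : singularCohomology ℚ ℚ (ComplexPoints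
        (fiberOver f (Subtype.val s))) k ≃ₗ[ℚ]
        singularCohomology ℚ ℚ (ComplexPoints (fiberOver f (Subtype.val t))) k),
        (∀ v, ofRatClass _ k (T v) = transportFun f k hU ⟦ε⟧ (ofRatClass _ k (Tx v))) → P t T) ∨
      IsNowhereDense {t : U | t ∈ Wc c ∧ ∀ (ε : Path x t), (∀ r, ε r ∈ Wc c) →
        ∀ (T : singularCohomology ℚ ℚ (ComplexPoints (fiberOver f (Subtype.val s))) k ≃ₗ[ℚ]
          singularCohomology ℚ ℚ (ComplexPoints (fiberOver f (Subtype.val t))) k),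
        (∀ v, ofRatClass _ k (T v) = transportFun f k hU ⟦ε⟧ (ofRatClass _ k (Tx v))) → P t T})
    {t₀ : U} {δ₀ : Path.Homotopic.Quotient s t₀} {T₀ : singularCohomology ℚ ℚ (ComplexPoints (fiberOver f
      (Subtype.val s))) k ≃ₗ[ℚ]
      singularCohomology ℚ ℚ (ComplexPoints (fiberOver f (Subtype.val t₀))) k}
    (hT₀ : ∀ v, ofRatClass _ k (T₀ v) = transportFun f k hU δ₀ (ofRatClass _ k v))
    (hfull₀ : ∀ c, t₀ ∈ Wc c → ∀ t ∈ Wc c, ∀ (ε : Path t₀ t), (∀ r, ε r ∈ Wc c) →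
      ∀ (T : singularCohomology ℚ ℚ (ComplexPoints (fiberOver f (Subtype.val s))) k ≃ₗ[ℚ]
        singularCohomology ℚ ℚ (ComplexPoints (fiberOver f (Subtype.val t))) k),
      (∀ v, ofRatClass _ k (T v) = transportFun f k hU ⟦ε⟧ (ofRatClass _ k (T₀ v))) → P t T)
    {t : U} (δ : Path.Homotopic.Quotient s t) (T : singularCohomology ℚ ℚ (ComplexPoints (fiberOver f
      (Subtype.val s))) k ≃ₗ[ℚ]
      singularCohomology ℚ ℚ (ComplexPoints (fiberOver f (Subtype.val t))) k)
    (hT : ∀ v, ofRatClass _ k (T v) = transportFun f k hU δ (ofRatClass _ k v)) : P t T := by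
  classical
  -- a path `γ` from `t₀` to `t` in the class `δ₀⁻¹ δ`, and its lifts at the classes `T₀ bⱼ ⊗ 1`
  obtain ⟨γ, hγ⟩ : ∃ γ : Path t₀ t, (⟦γ⟧ : Path.Homotopic.Quotient t₀ t) = δ₀.symm.trans δ :=
    ⟨(δ₀.symm.trans δ).out, Quotient.out_eq _⟩
  have hΛ := fun j ↦ exists_path_transportFun f k hU γ (ofRatClass _ k (T₀ (b j)))
  choose Λ hΛ using hΛ
  -- the initial segments of `γ` and the rational transports along `δ₀ · γ|[0,u]`
  obtain ⟨seg, hseg⟩ : ∃ seg : ∀ u : unitInterval, Path t₀ (γ u),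
      ∀ u, seg u = (γ.truncateOfLE u.2.1).cast γ.extend_zero.symm (γ.extend_extends' u).symm :=
    ⟨_, fun _ ↦ rfl⟩
  have hTu := fun u ↦ exists_ratTransport f k hU hrat (δ₀.trans ⟦seg u⟧)
  choose Tu hTu using hTu
  -- KEY: on the basis, the state `T_u` is read off from the lifts
  have key : ∀ u j, ofRatClass _ k (Tu u (b j)) = (Λ j u).clsAt (hΛ j u) := by
    intro u j
    rw [hTu u (b j), transportFun_trans, ← hT₀ (b j), hseg,
      transportFun_truncate f k hU γ _ (Λ j) (hΛ j) u]
  -- the good set of parameters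
  let Q : unitInterval → Prop := fun u ↦ ∀ c, γ u ∈ Wc c → ∀ t' ∈ Wc c, ∀ (ε : Path (γ u) t'),
    (∀ r, ε r ∈ Wc c) → ∀ (T' : singularCohomology ℚ ℚ (ComplexPoints (fiberOver f (Subtype.val s))) k ≃ₗ[ℚ]
      singularCohomology ℚ ℚ (ComplexPoints (fiberOver f (Subtype.val t'))) k),
    (∀ v, ofRatClass _ k (T' v) = transportFun f k hU ⟦ε⟧ (ofRatClass _ k (Tu u v))) → P t' T'
  -- `0` is good: transfer from `(t₀, T₀)` to `(γ 0, T_0)` (the same point)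
  have h0 : Q 0 := by
    intro c hc
    obtain ⟨c₀, hc₀⟩ := hcov t₀
    have hγ0 : γ 0 = t₀ := γ.source
    have h0c₀ : γ 0 ∈ Wc c₀ := by rw [hγ0]; exact hc₀
    refine full_transfer f k hU s P b (hWo c₀) (hWpc c₀) (hBo c₀) (hWB c₀) (hWo c) (hBo c)
      (hbij c) (hWB c) hc₀ h0c₀ hc (fun j ↦ ?_) (hfull₀ c₀ hc₀) (hdich c (γ 0) hc (Tu 0) ⟨_, hTu 0⟩)
    obtain ⟨ξ, hξ⟩ := (hbij c₀ (hWB c₀ t₀ hc₀)).2 (ofRatClass _ k (T₀ (b j)))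
    refine ⟨ξ, hξ, ?_⟩
    rw [key 0 j]
    symm
    rw [FiberClass.clsAt_eq_iff, (Λ j).source, ← hξ]
    exact FiberClass.mk_fiberRestrict_congr f k hγ0.symm _ _ ξ
  -- `Q` is locally constant
  have hloc : ∀ u₀ : unitInterval, ∀ᶠ u in 𝓝 u₀, (Q u₀ ↔ Q u) := by
    intro u₀
    obtain ⟨c₀, hc₀⟩ := hcov (γ u₀)
    have hev : ∀ j, ∃ ξ : singularCohomology ℂ ℂ (tubeOver f (Bc c₀)) k,
        fiberRestrict f (hWB c₀ _ hc₀) k ξ = (Λ j u₀).clsAt (hΛ j u₀) ∧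
        ∀ᶠ u in 𝓝 u₀, ∃ hB : (γ u).1 ∈ Bc c₀, (Λ j u).clsAt (hΛ j u) = fiberRestrict f hB k ξ :=
      fun j ↦ FiberClass.eventually_eq_fiberRestrict f k hU
        (continuous_mk_clsAt_path f k γ (Λ j) (hΛ j)).continuousAt (hBo c₀) (hBU c₀)
        (hWB c₀ _ hc₀) (hbij c₀ (hWB c₀ _ hc₀))
    choose ξ hξ₀ hξ using hev
    have hW₀ : ∀ᶠ u in 𝓝 u₀, γ u ∈ Wc c₀ :=
      γ.continuous.continuousAt.preimage_mem_nhds ((hWo c₀).mem_nhds hc₀)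
    filter_upwards [hW₀, Filter.eventually_all.2 hξ] with u huW hu
    have hrel : ∀ j, ∃ η : singularCohomology ℂ ℂ (tubeOver f (Bc c₀)) k,
        fiberRestrict f (hWB c₀ _ hc₀) k η = ofRatClass _ k (Tu u₀ (b j)) ∧
        fiberRestrict f (hWB c₀ _ huW) k η = ofRatClass _ k (Tu u (b j)) := by
      intro j
      obtain ⟨hB, hj⟩ := hu j
      exact ⟨ξ j, by rw [key, hξ₀], by rw [key, hj]⟩
    have hrel' : ∀ j, ∃ η : singularCohomology ℂ ℂ (tubeOver f (Bc c₀)) k,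
        fiberRestrict f (hWB c₀ _ huW) k η = ofRatClass _ k (Tu u (b j)) ∧
        fiberRestrict f (hWB c₀ _ hc₀) k η = ofRatClass _ k (Tu u₀ (b j)) :=
      fun j ↦ let ⟨η, h₁, h₂⟩ := hrel j; ⟨η, h₂, h₁⟩
    constructor
    · intro hQ c hc
      exact full_transfer f k hU s P b (hWo c₀) (hWpc c₀) (hBo c₀) (hWB c₀) (hWo c) (hBo c)
        (hbij c) (hWB c) hc₀ huW hc hrel (hQ c₀ hc₀) (hdich c (γ u) hc (Tu u) ⟨_, hTu u⟩)
    · intro hQ c hc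
      exact full_transfer f k hU s P b (hWo c₀) (hWpc c₀) (hBo c₀) (hWB c₀) (hWo c) (hBo c)
        (hbij c) (hWB c) huW hc₀ hc hrel' (hQ c₀ huW) (hdich c (γ u₀) hc (Tu u₀) ⟨_, hTu u₀⟩)
  -- hence every parameter is good
  have hall : ∀ u, Q u := by
    have hclopen : IsClopen {u : unitInterval | Q u} := by
      constructor
      · rw [← isOpen_compl_iff, isOpen_iff_mem_nhds]
        intro u₀ hu₀
        filter_upwards [hloc u₀] with u hu
        exact fun h ↦ hu₀ (hu.2 h)
      · rw [isOpen_iff_mem_nhds]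
        intro u₀ hu₀
        filter_upwards [hloc u₀] with u hu
        exact hu.1 hu₀
    have huniv : {u : unitInterval | Q u} = Set.univ :=
      (isClopen_iff.1 hclopen).resolve_left (Set.nonempty_iff_ne_empty.1 ⟨0, h0⟩)
    exact fun u ↦ (Set.eq_univ_iff_forall.1 huniv u :)
  -- evaluate at `u = 1`: the state `T_1` at `γ 1 = t` is `T`
  obtain ⟨c₁, hc₁⟩ := hcov t
  have hγ1 : γ 1 = t := γ.target
  have h1c₁ : γ 1 ∈ Wc c₁ := by rw [hγ1]; exact hc₁
  let p : Path (γ 1) t := (Path.refl t).cast hγ1 rfl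
  have hp : ∀ r, p r ∈ Wc c₁ := fun _ ↦ hc₁
  refine hall 1 c₁ h1c₁ t hc₁ p hp T ?_
  refine forall_eq_of_eqOn_basis b (fun v ↦ ofRatClass _ k (T v))
    (fun v ↦ transportFun f k hU ⟦p⟧ (ofRatClass _ k (Tu 1 v))) ?_ ?_ ?_ ?_ (fun j ↦ ?_)
  · intro v w; simp only [map_add]
  · intro q v; rw [LinearEquiv.map_smul, ofRatClass_smul]
  · intro v w; simp only [map_add, transportFun_add]
  · intro q v; rw [LinearEquiv.map_smul, ofRatClass_smul, transportFun_smul]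
  · change ofRatClass _ k (T (b j)) = transportFun f k hU ⟦p⟧ (ofRatClass _ k (Tu 1 (b j)))
    obtain ⟨η, hη⟩ := (hbij c₁ (hWB c₁ _ h1c₁)).2 (ofRatClass _ k (Tu 1 (b j)))
    rw [← hη, transportFun_fiberRestrict f k hU (hBo c₁) p (fun r ↦ hWB c₁ _ (hp r))
      (hWB c₁ _ h1c₁) (hWB c₁ _ hc₁)]
    have h1 : (⟨t.1, fiberRestrict f (hWB c₁ _ hc₁) k η⟩ : FiberClass f k) =
        ⟨t.1, ofRatClass _ k (T (b j))⟩ := by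
      rw [← FiberClass.mk_fiberRestrict_congr f k hγ1 (hWB c₁ _ h1c₁) (hWB c₁ _ hc₁) η, hη,
        key 1 j, FiberClass.mk_clsAt, (Λ j).target, hT₀ (b j), hγ, ← transportFun_trans,
        ← Path.Homotopic.Quotient.trans_assoc, Path.Homotopic.Quotient.trans_symm,
        Path.Homotopic.Quotient.refl_trans, ← hT (b j)]
    exact ((FiberClass.mk_eq_mk_iff _ _).1 h1).symm

end Propagate

/-! ### The generic point (Baire) -/

section Generic

variable {𝒳 S : SchemeOver ℂ} (f : 𝒳 ⟶ S) (k : ℕ) {U : Set (ComplexPoints S)}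
  (hU : IsCohomologicallyLocallyTrivialOn f U)

/-- **Existence of a generic point (Deligne 1972, Prop. 7.5: the Baire argument, abstract form).**
Let `f : 𝒳 ⟶ S` be cohomologically locally trivial over `U ⊆ S(ℂ)` in degree `k`, with transport
preserving rational classes, `U` locally path connected, second countable and Baire (e.g. `S(ℂ)`
for `S` smooth quasi-projective), the rational fibres `Hᵏ(X_t(ℂ); ℚ)` finite-dimensional, and let
`P i t T` (`i` in a countable set) be properties of the rational transports
`T : Hᵏ(X_s; ℚ) ≃ Hᵏ(X_t; ℚ)` (e.g. "the rational tensor `ζᵢ` is a Hodge tensor of `T^* H_t`").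
HYPOTHESIS (local analytic dichotomy): every point has arbitrarily small path-connected open
neighbourhoods `W` such that for every `i`, every base point `x ∈ W` and every admissible state
`Tx` at `x` (a rational transport along some path from `s`), the locus of points `t ∈ W` at which
`P i` holds for the continuation of `Tx` along paths inside `W` is either all of `W` or nowhere
dense. CONCLUSION: there is a point `t₀` (joined to `s` by `δ₀`, with rational transport `T₀`)
which is GENERIC: every `P i` holding at `(t₀, T₀)` holds at every `(t, δ, T)`. Proof: the loci
based at the centres of a countable subcover, over the countably many `(i, T)`, which are nowhere
dense have nowhere-dense closures; off their union (Baire) pick `t₀` in the path component of `s`;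
fullness at `t₀` (`full_of_generic`) propagates everywhere (`propagate_of_full`).
[cite: Deligne1972WeilK3, Prop. 7.5] [cite: Klingler2022HodgeICM, §2.6] -/
theorem exists_generic_of_lociDichotomy [LocallyPathConnectedSpace U] [SecondCountableTopology U]
    [BaireSpace U] [∀ x : U, Module.Finite ℚ (singularCohomology ℚ ℚ (ComplexPoints (fiberOver f
      (Subtype.val x))) k)] (s : U)
    (hrat : ∀ (x y : U) (γ : Path.Homotopic.Quotient x y) (α : complexBetti (fiberOver f x.1) k),
      IsRationalClass α → IsRationalClass (transportFun f k hU γ α))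
    {ι : Type*} [Countable ι] (P : ι → ∀ t : U, (singularCohomology ℚ ℚ (ComplexPoints (fiberOver f
      (Subtype.val s))) k ≃ₗ[ℚ]
      singularCohomology ℚ ℚ (ComplexPoints (fiberOver f (Subtype.val t))) k) → Prop)
    (hloc : ∀ (t₁ : U), ∀ N ∈ 𝓝 t₁, ∃ W : Set U, IsOpen W ∧ t₁ ∈ W ∧ W ⊆ N ∧ IsPathConnected W ∧
      ∀ (i : ι) (x : U), x ∈ W → ∀ (Tx : singularCohomology ℚ ℚ (ComplexPoints (fiberOver f (Subtype.val s))) k ≃ₗ[ℚ]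
        singularCohomology ℚ ℚ (ComplexPoints (fiberOver f (Subtype.val x))) k),
        (∃ δ : Path.Homotopic.Quotient s x,
          ∀ v, ofRatClass _ k (Tx v) = transportFun f k hU δ (ofRatClass _ k v)) →
        (∀ t ∈ W, ∀ (ε : Path x t), (∀ r, ε r ∈ W) → ∀ (T : singularCohomology ℚ ℚ (ComplexPoints (fiberOver f
          (Subtype.val s))) k ≃ₗ[ℚ]
          singularCohomology ℚ ℚ (ComplexPoints (fiberOver f (Subtype.val t))) k),
          (∀ v, ofRatClass _ k (T v) = transportFun f k hU ⟦ε⟧ (ofRatClass _ k (Tx v))) →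
            P i t T) ∨
        IsNowhereDense {t : U | t ∈ W ∧ ∀ (ε : Path x t), (∀ r, ε r ∈ W) →
          ∀ (T : singularCohomology ℚ ℚ (ComplexPoints (fiberOver f (Subtype.val s))) k ≃ₗ[ℚ]
            singularCohomology ℚ ℚ (ComplexPoints (fiberOver f (Subtype.val t))) k),
          (∀ v, ofRatClass _ k (T v) = transportFun f k hU ⟦ε⟧ (ofRatClass _ k (Tx v))) →
            P i t T}) :
    ∃ (t₀ : U) (δ₀ : Path.Homotopic.Quotient s t₀) (T₀ : singularCohomology ℚ ℚ (ComplexPoints (fiberOver f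
      (Subtype.val s))) k ≃ₗ[ℚ]
      singularCohomology ℚ ℚ (ComplexPoints (fiberOver f (Subtype.val t₀))) k),
      (∀ v, ofRatClass _ k (T₀ v) = transportFun f k hU δ₀ (ofRatClass _ k v)) ∧
      ∀ i, P i t₀ T₀ → ∀ (t : U) (δ : Path.Homotopic.Quotient s t) (T : singularCohomology ℚ ℚ (ComplexPoints
        (fiberOver f (Subtype.val s))) k ≃ₗ[ℚ]
        singularCohomology ℚ ℚ (ComplexPoints (fiberOver f (Subtype.val t))) k),
        (∀ v, ofRatClass _ k (T v) = transportFun f k hU δ (ofRatClass _ k v)) → P i t T := by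
  classical
  -- Step 1: charts `W ⊆ B` (path-connected opens inside trivialising opens) around every point
  have hchart : ∀ t₁ : U, ∃ (W : Set U) (B : Set (ComplexPoints S)), IsOpen W ∧ t₁ ∈ W ∧
      IsPathConnected W ∧ IsOpen B ∧ B ⊆ U ∧ (∀ t ∈ W, (t : ComplexPoints S) ∈ B) ∧
      (∀ ⦃z⦄ (hz : z ∈ B), Function.Bijective (fiberRestrict f hz k)) ∧
      ∀ (i : ι) (x : U), x ∈ W → ∀ (Tx : singularCohomology ℚ ℚ (ComplexPoints (fiberOver f (Subtype.val s))) k ≃ₗ[ℚ]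
        singularCohomology ℚ ℚ (ComplexPoints (fiberOver f (Subtype.val x))) k),
        (∃ δ : Path.Homotopic.Quotient s x,
          ∀ v, ofRatClass _ k (Tx v) = transportFun f k hU δ (ofRatClass _ k v)) →
        (∀ t ∈ W, ∀ (ε : Path x t), (∀ r, ε r ∈ W) → ∀ (T : singularCohomology ℚ ℚ (ComplexPoints (fiberOver f
          (Subtype.val s))) k ≃ₗ[ℚ]
          singularCohomology ℚ ℚ (ComplexPoints (fiberOver f (Subtype.val t))) k),
          (∀ v, ofRatClass _ k (T v) = transportFun f k hU ⟦ε⟧ (ofRatClass _ k (Tx v))) →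
            P i t T) ∨
        IsNowhereDense {t : U | t ∈ W ∧ ∀ (ε : Path x t), (∀ r, ε r ∈ W) →
          ∀ (T : singularCohomology ℚ ℚ (ComplexPoints (fiberOver f (Subtype.val s))) k ≃ₗ[ℚ]
            singularCohomology ℚ ℚ (ComplexPoints (fiberOver f (Subtype.val t))) k),
          (∀ v, ofRatClass _ k (T v) = transportFun f k hU ⟦ε⟧ (ofRatClass _ k (Tx v))) →
            P i t T} := by
    intro t₁
    obtain ⟨B, hBo, ht₁B, -, hBU, hbij⟩ := hU.exists_nhds_bijective t₁.2 Set.univ Filter.univ_mem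
    have hN : (Subtype.val ⁻¹' B : Set U) ∈ 𝓝 t₁ :=
      (hBo.preimage continuous_subtype_val).mem_nhds ht₁B
    obtain ⟨W, hWo, ht₁W, hWN, hWpc, hW⟩ := hloc t₁ _ hN
    exact ⟨W, B, hWo, ht₁W, hWpc, hBo, hBU, fun t ht ↦ hWN ht, fun z hz ↦ hbij k hz, hW⟩
  choose Wp Bp hWo ht₁W hWpc hBo hBU hWB hbij hdichp using hchart
  -- Step 2: a countable subcover
  obtain ⟨Cset, hCc, hCU⟩ := TopologicalSpace.isOpen_iUnion_countable Wp hWo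
  have hcov : ∀ t : U, ∃ c : Cset, t ∈ Wp c.1 := by
    intro t
    have ht : t ∈ ⋃ i ∈ Cset, Wp i := by
      rw [hCU]
      exact Set.mem_iUnion.2 ⟨t, ht₁W t⟩
    obtain ⟨i, hi⟩ := Set.mem_iUnion.1 ht
    obtain ⟨hi, hti⟩ := Set.mem_iUnion.1 hi
    exact ⟨⟨i, hi⟩, hti⟩
  haveI : Countable Cset := hCc.to_subtype
  haveI : ∀ x : U, Countable (singularCohomology ℚ ℚ (ComplexPoints (fiberOver f (Subtype.val s))) k ≃ₗ[ℚ]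
    singularCohomology ℚ ℚ (ComplexPoints (fiberOver f (Subtype.val x))) k) := fun x ↦ countable_linearEquiv_rat _ _
  -- Step 3: the loci based at the centres, and the Baire argument
  obtain ⟨L, hL⟩ : ∃ L : ∀ (c : Cset) (i : ι), (singularCohomology ℚ ℚ (ComplexPoints (fiberOver f
    (Subtype.val s))) k ≃ₗ[ℚ]
    singularCohomology ℚ ℚ (ComplexPoints (fiberOver f (Subtype.val c.1))) k) → Set U,
      ∀ c i T', L c i T' = {t : U | t ∈ Wp c.1 ∧ ∀ (ε : Path c.1 t), (∀ r, ε r ∈ Wp c.1) →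
        ∀ (T : singularCohomology ℚ ℚ (ComplexPoints (fiberOver f (Subtype.val s))) k ≃ₗ[ℚ]
          singularCohomology ℚ ℚ (ComplexPoints (fiberOver f (Subtype.val t))) k),
        (∀ v, ofRatClass _ k (T v) = transportFun f k hU ⟦ε⟧ (ofRatClass _ k (T' v))) →
          P i t T} := ⟨_, fun _ _ _ ↦ rfl⟩
  obtain ⟨F, hF⟩ : ∃ F : (Σ c : Cset, ι × (singularCohomology ℚ ℚ (ComplexPoints (fiberOver f
    (Subtype.val s))) k ≃ₗ[ℚ]
    singularCohomology ℚ ℚ (ComplexPoints (fiberOver f (Subtype.val c.1))) k)) → Set U,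
      ∀ q, F q = {t : U | IsNowhereDense (L q.1 q.2.1 q.2.2) → t ∉ closure (L q.1 q.2.1 q.2.2)} :=
    ⟨_, fun _ ↦ rfl⟩
  have hFo : ∀ q, IsOpen (F q) := by
    intro q
    by_cases hq : IsNowhereDense (L q.1 q.2.1 q.2.2)
    · have h : F q = (closure (L q.1 q.2.1 q.2.2))ᶜ := by
        rw [hF]
        exact Set.ext fun t ↦ ⟨fun ht ↦ ht hq, fun ht _ ↦ ht⟩
      rw [h]
      exact isClosed_closure.isOpen_compl
    · have h : F q = Set.univ := by
        rw [hF]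
        exact Set.eq_univ_of_forall fun t h ↦ (hq h).elim
      rw [h]
      exact isOpen_univ
  have hFd : ∀ q, Dense (F q) := by
    intro q
    by_cases hq : IsNowhereDense (L q.1 q.2.1 q.2.2)
    · have h : F q = (closure (L q.1 q.2.1 q.2.2))ᶜ := by
        rw [hF]
        exact Set.ext fun t ↦ ⟨fun ht ↦ ht hq, fun ht _ ↦ ht⟩
      rw [h]
      exact interior_eq_empty_iff_dense_compl.1 hq
    · have h : F q = Set.univ := by
        rw [hF]
        exact Set.eq_univ_of_forall fun t h ↦ (hq h).elim
      rw [h]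
      exact dense_univ
  have hD : Dense (⋂ q, F q) := dense_iInter_of_isOpen hFo hFd
  -- Step 4: the generic point `t₀`, in the path component of `s`
  obtain ⟨t₀, ht₀s, ht₀D⟩ := hD.inter_open_nonempty (pathComponent s) (IsOpen.pathComponent s)
    ⟨s, mem_pathComponent_self s⟩
  have hjoin : Joined s t₀ := ht₀s
  obtain ⟨T₀, hT₀⟩ := exists_ratTransport f k hU hrat (⟦hjoin.somePath⟧ : Path.Homotopic.Quotient s t₀)
  refine ⟨t₀, ⟦hjoin.somePath⟧, T₀, hT₀, fun i hP t δ T hT ↦ ?_⟩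
  have hgen : ∀ (c : Cset) (T' : singularCohomology ℚ ℚ (ComplexPoints (fiberOver f (Subtype.val s))) k ≃ₗ[ℚ]
    singularCohomology ℚ ℚ (ComplexPoints (fiberOver f (Subtype.val c.1))) k),
      IsNowhereDense (L c i T') → t₀ ∉ closure (L c i T') := by
    intro c T' hnd
    have h := Set.mem_iInter.1 ht₀D ⟨c, i, T'⟩
    rw [hF] at h
    exact h hnd
  -- Step 5: fullness at `t₀` in every chart through it, then propagation
  have hfull₀ : ∀ c : Cset, t₀ ∈ Wp c.1 → ∀ t' ∈ Wp c.1, ∀ (ε : Path t₀ t'), (∀ r, ε r ∈ Wp c.1) →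
      ∀ (T' : singularCohomology ℚ ℚ (ComplexPoints (fiberOver f (Subtype.val s))) k ≃ₗ[ℚ]
        singularCohomology ℚ ℚ (ComplexPoints (fiberOver f (Subtype.val t'))) k),
      (∀ v, ofRatClass _ k (T' v) = transportFun f k hU ⟦ε⟧ (ofRatClass _ k (T₀ v))) → P i t' T' := by
    intro c hc
    refine full_of_generic f k hU s hrat (P i) (hWpc c.1) (hBo c.1) (hbij c.1) (hWB c.1)
      (ht₁W c.1) hc hT₀ hP (fun T' ↦ ?_) (fun T' hT' ↦ hdichp c.1 i c.1 (ht₁W c.1) T' hT')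
    simpa only [hL] using hgen c T'
  exact propagate_of_full f k hU s hrat (P i) (Module.finBasis ℚ (singularCohomology ℚ ℚ (ComplexPoints
    (fiberOver f (Subtype.val s))) k))
    (fun c : Cset ↦ Wp c.1) (fun c ↦ Bp c.1) (fun c ↦ hWo c.1) (fun c ↦ hWpc c.1)
    (fun c ↦ hBo c.1) (fun c ↦ hBU c.1) (fun c ↦ hbij c.1) (fun c ↦ hWB c.1) hcov
    (fun c x hx Tx hTx ↦ hdichp c.1 i x hx Tx hTx) hT₀ hfull₀ δ T hT

end Generic

/-! ### The named fact from the analytic dichotomy of Hodge loci -/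

section Geometric

/-- Quasi-projectivity is stable under extension of the base field (private copy of
`IsQuasiProjectiveOver.baseChangeHom` of the concurrently edited `HodgeGenericQbarDescentProofs`).
[cite: Liu2002, Prop. 3.1.23 and Rem. 3.1.20] -/
private theorem isQuasiProjectiveOver_baseChangeHomT {K L : Type} [Field K] [Field L]
    (σ : K →+* L) {X : Motives.SchemeOver K} (h : IsQuasiProjectiveOver X) :
    IsQuasiProjectiveOver ((Motives.baseChangeHom σ).obj X) := by
  obtain ⟨P, j, hP, hj⟩ := h
  letI := σ.toAlgebra
  refine ⟨(Motives.baseChangeHom σ).obj P, (Motives.baseChangeHom σ).map j, hP.baseChange_obj L, ?_⟩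
  exact MorphismProperty.IsStableUnderBaseChange.of_isPullback
    (Motives.isPullback_baseChange_map_left L j).flip hj

/-- **`bku_finite_monodromyOrbit_of_isHodgeGenericIn` from the ANALYTIC DICHOTOMY OF HODGE LOCI.**
The hypothesis `hD` is the local statement behind Deligne's Prop. 7.5 (Cattani–Deligne–Kaplan 1995,
§1: "the locus where a flat section remains of type `(p,p)` is a complex analytic subvariety";
Voisin II §5.3.1; it follows from Griffiths' holomorphy of the Hodge bundles `F^p` and the identity
principle): for a smooth projective family `f : 𝒳 ⟶ S` over a smooth quasi-projective complex base,
Hodge-symmetric models `A t`, degree `k`, base point `s`, every point of `S(ℂ)` has arbitrarily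
small path-connected open neighbourhoods `W` such that, for every rational tensor
`ζ ∈ T^{a,b} Hᵏ(X_s; ℚ)`, every base point `x ∈ W` and every rational transport `Tx` to `x` along a
path from `s`, the locus of `t ∈ W` at which `ζ` is a weight-`0` Hodge tensor of type `(0,0)` of
`T^* H_t` for the continuation `T` of `Tx` along paths inside `W` is either all of `W` or nowhere
dense. From `hD`, Deligne's Baire argument `exists_generic_of_lociDichotomy` (with `S(ℂ)` locally
path connected, second countable and Baire: a topological manifold, Serre GAGA §2) produces a
tensor-generic point for every base change to `ℂ` of a `ℚ̄`-family over a smooth base, which is the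
hypothesis of `bku_finite_monodromyOrbit_of_isHodgeGenericIn_of_generic`. [cite: Deligne1972WeilK3, Prop. 7.5]
[cite: CattaniDeligneKaplan1995JAMS, §1] [cite: Klingler2022HodgeICM, §2.6]
[cite: BaldiKlinglerUllmo2024, §3.2] -/
theorem bku_finite_monodromyOrbit_of_isHodgeGenericIn_of_hodgeLociDichotomy
    (hD : ∀ [HodgeTensorFacts.{0, 0}] ⦃𝒳 S : SchemeOver ℂ⦄ (f : 𝒳 ⟶ S) (n k d : ℕ)
      (hf : IsSmoothProjectiveFamily f n) (_ : IsQuasiProjectiveOver S)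
      [SmoothOfRelativeDimension d S.hom]
      (hU : IsCohomologicallyLocallyTrivialOn f (Set.univ : Set (ComplexPoints S)))
      (A : ∀ t : ComplexPoints S, HodgeModel n (fiberOver f t)) (hA : ∀ t, (A t).IsHodgeSymmetric)
      [∀ t, Module.Finite ℚ (singularCohomology ℚ ℚ (ComplexPoints (fiberOver f t)) k)]
      (s t₁ : (Set.univ : Set (ComplexPoints S))), ∀ N ∈ 𝓝 t₁,
      ∃ W : Set (Set.univ : Set (ComplexPoints S)), IsOpen W ∧ t₁ ∈ W ∧ W ⊆ N ∧ IsPathConnected W ∧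
      ∀ (a b : ℕ) (ζ : hodgeTensorSpace (singularCohomology ℚ ℚ (ComplexPoints (fiberOver f
        (Subtype.val s))) k) a b) (x : (Set.univ : Set (ComplexPoints S))),
        x ∈ W → ∀ (Tx : singularCohomology ℚ ℚ (ComplexPoints (fiberOver f (Subtype.val s))) k ≃ₗ[ℚ]
          singularCohomology ℚ ℚ (ComplexPoints (fiberOver f (Subtype.val x))) k),
        (∃ δ : Path.Homotopic.Quotient s x,
          ∀ v, ofRatClass _ k (Tx v) = transportFun f k hU δ (ofRatClass _ k v)) →
        (∀ t ∈ W, ∀ (ε : Path x t), (∀ r, ε r ∈ W) → ∀ (T : singularCohomology ℚ ℚ (ComplexPoints (fiberOver f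
          (Subtype.val s))) k ≃ₗ[ℚ]
          singularCohomology ℚ ℚ (ComplexPoints (fiberOver f (Subtype.val t))) k),
          (∀ v, ofRatClass _ k (T v) = transportFun f k hU ⟦ε⟧ (ofRatClass _ k (Tx v))) →
          ζ ∈ ((((A t.1).hodgeStructure (hf.isSmoothProjective t.1) (hA t.1) k).comapEquiv T).tensorSpace
            a b).hodgeClasses 0) ∨
        IsNowhereDense {t : (Set.univ : Set (ComplexPoints S)) | t ∈ W ∧ ∀ (ε : Path x t),
          (∀ r, ε r ∈ W) → ∀ (T : singularCohomology ℚ ℚ (ComplexPoints (fiberOver f (Subtype.val s))) k ≃ₗ[ℚ]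
            singularCohomology ℚ ℚ (ComplexPoints (fiberOver f (Subtype.val t))) k),
          (∀ v, ofRatClass _ k (T v) = transportFun f k hU ⟦ε⟧ (ofRatClass _ k (Tx v))) →
          ζ ∈ ((((A t.1).hodgeStructure (hf.isSmoothProjective t.1) (hA t.1) k).comapEquiv T).tensorSpace
            a b).hodgeClasses 0}) :
    bku_finite_monodromyOrbit_of_isHodgeGenericIn := by
  refine bku_finite_monodromyOrbit_of_isHodgeGenericIn_of_generic ?_
  intro _ σ 𝒳₀ S₀ f₀ n p hf h𝒳₀ hS₀ _ _ A hA _ s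
  obtain ⟨d, hd⟩ := exists_smoothOfRelativeDimension_baseChangeHom σ S₀
  haveI := hd
  have hS := isQuasiProjectiveOver_baseChangeHomT σ hS₀
  haveI : LocallyOfFiniteType ((baseChangeHom σ).obj S₀).hom := hS.locallyOfFiniteType
  haveI : IsSeparated ((baseChangeHom σ).obj S₀).hom := hS.isVarietyPair_ofScheme.isSeparated
  haveI : QuasiCompact ((baseChangeHom σ).obj S₀).hom := hS.isVarietyPair_ofScheme.quasiCompact
  haveI : CompactSpace ((baseChangeHom σ).obj S₀).left :=
    QuasiCompact.compactSpace_of_compactSpace ((baseChangeHom σ).obj S₀).hom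
  haveI : T2Space (ComplexPoints ((baseChangeHom σ).obj S₀)) :=
    Literature.NumberTheory.Transcendental.t2Space_algPoints_holds _ ℂ
  letI := Motives.ComplexPoints.chartedSpace ((baseChangeHom σ).obj S₀) d
  haveI : LocallyPathConnectedSpace (ComplexPoints ((baseChangeHom σ).obj S₀)) :=
    ChartedSpace.locallyPathConnectedSpace (EuclideanSpace ℝ (Fin (2 * d))) _
  haveI : LocallyCompactSpace (ComplexPoints ((baseChangeHom σ).obj S₀)) :=
    ChartedSpace.locallyCompactSpace (EuclideanSpace ℝ (Fin (2 * d))) _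
  haveI : SecondCountableTopology (ComplexPoints ((baseChangeHom σ).obj S₀)) :=
    Motives.ComplexPoints.secondCountableTopology_of_compactSpace_holds _
  haveI : LocallyPathConnectedSpace (Set.univ : Set (ComplexPoints ((baseChangeHom σ).obj S₀))) :=
    isOpen_univ.locallyPathConnectedSpace
  haveI : LocallyCompactSpace (Set.univ : Set (ComplexPoints ((baseChangeHom σ).obj S₀))) :=
    isOpen_univ.isOpenEmbedding_subtypeVal.locallyCompactSpace
  haveI : ∀ a b : ℕ, Countable (hodgeTensorSpace
      (singularCohomology ℚ ℚ (ComplexPoints (fiberOver ((baseChangeHom σ).map f₀) s)) (2 * p)) a b) :=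
    fun a b ↦ by
      haveI : Module.Finite ℚ (hodgeTensorSpace
          (singularCohomology ℚ ℚ (ComplexPoints (fiberOver ((baseChangeHom σ).map f₀) s)) (2 * p)) a b) :=
        Module.Finite.of_basis (hodgeTensorBasis (Module.finBasis ℚ _) a b)
      exact countable_of_module_finite_rat _
  have hrat : ∀ (x y : (Set.univ : Set (ComplexPoints ((baseChangeHom σ).obj S₀))))
      (γ : Path.Homotopic.Quotient x y)
      (α : complexBetti (fiberOver ((baseChangeHom σ).map f₀) x.1) (2 * p)), IsRationalClass α →
      IsRationalClass (transportFun ((baseChangeHom σ).map f₀) (2 * p)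
        (isCohomologicallyLocallyTrivialOn_univ_baseChangeHom σ f₀ hf hS₀) γ α) :=
    fun x y γ α hα ↦ isRationalClass_transportFun_of_isSmoothProjectiveFamily _ (2 * p) d hf hS γ hα
  obtain ⟨t₀, δ₀, T₀, hT₀, hgen⟩ := exists_generic_of_lociDichotomy ((baseChangeHom σ).map f₀) (2 * p)
    (isCohomologicallyLocallyTrivialOn_univ_baseChangeHom σ f₀ hf hS₀) ⟨s, Set.mem_univ s⟩ hrat
    (ι := Σ a b : ℕ, hodgeTensorSpace
      (singularCohomology ℚ ℚ (ComplexPoints (fiberOver ((baseChangeHom σ).map f₀) s)) (2 * p)) a b)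
    (fun q t T ↦ q.2.2 ∈ ((((A t.1).hodgeStructure (hf.isSmoothProjective t.1) (hA t.1) (2 * p)).comapEquiv
      T).tensorSpace q.1 q.2.1).hodgeClasses 0)
    (fun t₁ N hN ↦ by
      obtain ⟨W, hWo, ht₁W, hWN, hWpc, hW⟩ := hD ((baseChangeHom σ).map f₀) n (2 * p) d hf hS
        (isCohomologicallyLocallyTrivialOn_univ_baseChangeHom σ f₀ hf hS₀) A hA ⟨s, Set.mem_univ s⟩ t₁ N hN
      exact ⟨W, hWo, ht₁W, hWN, hWpc, fun q x hx Tx hTx ↦ hW q.1 q.2.1 q.2.2 x hx Tx hTx⟩)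
  exact ⟨t₀.1, δ₀, T₀, hT₀, fun a b _ ζ hζ t δ T hT ↦ hgen ⟨a, b, ζ⟩ hζ ⟨t, Set.mem_univ t⟩ δ T hT⟩

end Geometric

end HodgeTheory

end Literature.AlgebraicGeometry.HodgeTheory

end
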